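/-
Copyright (c) 2026 the pub-hodgecm-mathlib formalisation cell (harness21).  Prover seat hodgecm-mathlib-K2E3-p28 (g4) (S6 hand under dealer R90-C14-plan (g2)),
card (G2) «TYPE-(2) DISCHARGE», FILE 1a = the per-class SHELL FORMULAS behind the reduction of the ramified type-(2) elliptic κ-identity (FILE 1b
`R90S6EllipticIdentityTypeTwoReduction` is the head; census `K2/K2E3-p28/g4/G2-DISCHARGE-CENSUS.md` 368559be56a7517e).  THEOREMS ONLY (no `def`, no `instance`, no notation,
no named-fact hypothesis, no `sorry`); lane `--supports stmt-HodgeConjecture-24833 --as helper` (count-neutral helper).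
-/
import Summits.HodgeConjecture.HodgeConjecture.Theorems.R90S6EllipticIdentityTypeOneShells  -- ★ p02 (g3) type-(1) twin: `sum_neg_one_pow_Ico_one_eq` (the alternating sum, REUSED by name); brings ★ GF1 2a p864913 `ncard_selfDual_displaced_add_eq_of_natCard_fixedBy_eq`, ★ G3-NUMBERS, ★ DICT0, ★ GF1 F1, ★ H2-NUMBERS (`sum_xiHCoeff_mul_shell_eq`, `ncard_selfDual_displaced_zero_eq_ncard_fixed_two`, `ncard_selfDual_displaced_eq_pow_mul_firstShell_two`, `xiHCoeff`), ★ `R90S6ShellSphereDictU2`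
import HarnessLib

/-!
# R90 · S6 — row E1.3.5.2.6, card (G2) FILE 1a: THE TYPE-(2) SHELL FORMULAS — G side per class in the fixed-coset counts, H side (ONE class) from `F₀(δ) = F₁(δ)`
# (`Theorems/R90S6EllipticIdentityTypeTwoShells.lean`)

Cell `hodgecm-mathlib`, crux H413 (`stmt-HodgeConjecture-24833`), route of record `HCCMUnconditional`; programme R90-TF, section S6 (base `R90-C14`, dealer
R90-C14-plan (g2)), seat K2E3-p28 (g4); card **(G2) «TYPE-(2) DISCHARGE»** of the RECORD target (E2) = typ1 sheet v2.3 `4c174fca74d7a58a` :468 ([BR₁] Thm. 1 = Rogawski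
Prop. 4.9.1 (b) for the ramified anisotropic torus `T ≃ E¹ × Res M¹`, read on the two Bruhat–Tits trees; Flicker 1998 Theorem 18 at `m = 0`).  This file holds the three
ingredient formulas; FILE 1b `R90S6EllipticIdentityTypeTwoReduction` composes them into the identity at every displacement `m`.

THE MATHEMATICS.  `K` a non-archimedean local field with the unramified conjugation datum `(σ, ϖ)`, residue field of order `q²` with `σ̄ = Frob_q`; `U₃ = U(σ, J₃)(K)`
acts on the `(q³+1, q+1)`-biregular tree `X₃` (hyperspecial = self-dual vertices; `K₀`, `K₁ = g₁K₀g₁⁻¹ ∩ U₃` the stabilisers of the hyperspecial root and of the adjacent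
special vertex, `g₁ = diag(1,1,ϖ)`), `U₂ = U(σ, J₂)(K)` on the `(q+1)`-regular tree `X₂`.  For `γ ∈ U₃`: `V₀(γ) = #Fix_γ(U₃ ⧸ K₀)`, `V₁(γ) = #Fix_γ(U₃ ⧸ K₁)`,
`S′(γ, k) = #{x hyperspecial : d(x, γx) = 2k}` (the shell `O_γ(1_{K₀ t^k K₀})` counts); for `δ ∈ U₂`: `S₂(δ, k) = #{x self-dual : d(x, δx) = 2k}`, `F₀(δ) ∕ F₁(δ)` the
`δ`-fixed self-dual ∕ `ϖ`-modular vertices.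
* §1 (pure arithmetic): the ONE-CLASS closed value of ★ `sum_xiHCoeff_mul_shell_eq` when BOTH first shells are `M`, `M + F = qF + 1`:
  `Σ_{k≤m} ξ_{m,k} S_k = q^{2m−3}(q³F − F + 1)` (`m` even) ∕ `q^{2(m−1)}(qF − q − F)` (`m ≥ 1` odd) [Macdonald V §3];
* §2 (G side, per class): `S′(γ,0) = V₀(γ)` (★ G3-NUMBERS + ★ DICT0) and, for `k ≥ 1`, `S′(γ,k) = q^{2k−3}(q³V₀ − V₁ + 1)` (`k` even) ∕ `q^{2(k−1)}(qV₁ − V₀ + 1)` (`k` odd)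
  as complex numbers — the cast of ★ GF1 2a §4 (additive in `ℕ` there) under its residual letters and the RECORD head's per-element finiteness letters;
* §3 (H side, ONE class): if `δ` fixes `P ≥ 1` self-dual and `P` `ϖ`-modular vertices of `X₂` — the type-(2) corner `t_H ∈ M¹` fixes an EDGE MIDPOINT and exactly the
  radius-`N` tube about it, `F₀ = F₁ = Σ_{k≤N} q^k` (★ HF2) — then `Fix(δ)` is finite with a fixed vertex, BOTH first shells are `M` with `M + P = qP + 1` (★ GF1 FILE 1 on the
  `(q+1)`-regular tree, both colours) and `S₂(δ,k) = q^{k−1} M` (★ H2-NUMBERS §2): the edge-midpoint symmetry `N₀ = N₁` replaces the ★ type swap of type (1)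
  [Rogawski Lemma 3.6.1: ONE endoscopic class].
HONEST LABEL: bookkeeping over ★ files; proves no printed global statement, discharges no citation, count-neutral until E1.3.5.2 ∕ E1.3.9 consume it.  HC_CM is proved
only modulo the 7 printed citations (2 remaining named inputs: hLiu418 = stmt-HodgeConjecture-24832, h413 = stmt-HodgeConjecture-24833) until rung 0 closes.

## References
* [Rogawski1990] J. D. Rogawski, *Automorphic Representations of Unitary Groups in Three Variables*, Ann. of Math. Stud. 123 (1990), §4.9 Prop. 4.9.1 (b) pp. 54–55;
  §3.6 Lemma 3.6.1 p. 28.  [Flicker1998UnitaryFL] Y. Z. Flicker, *Elementary proof of the fundamental lemma for a unitary group*, Canad. J. Math. 50 (1998), Thm 18 p. 97.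
* [Macdonald1971] I. G. Macdonald, *Spherical functions on a group of p-adic type* (1971), Ch. V §3.  [Serre1980Trees] J.-P. Serre, *Trees* (1980), I.6.4 Prop. 24, II.1.1.
* [Kottwitz1988] R. E. Kottwitz, *Tamagawa numbers*, Ann. of Math. 127 (1988), §2.
-/

set_option autoImplicit false
-- the mandated namespace repeats the single-problem summit's segment (`HodgeConjecture.HodgeConjecture`)
set_option linter.dupNamespace false

noncomputable section

open MulAction SimpleGraph Finset
open scoped WithZero Matrix MatrixGroups
open Literature.NumberTheory.Automorphic Literature.NumberTheory.Automorphic.HermitianLattice Literature.NumberTheory.Automorphic.UnitaryGroup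
open Literature.Combinatorics.SimpleGraph

namespace Summit.HodgeConjecture.HodgeConjecture.R90.S6


/-! ## §1 Pure arithmetic: the ONE-class closed value of `Σ_k ξ_{m,k} S_k` when `N₀ = N₁` (the alternating sum `Σ_{1≤k<m}(−1)^k` is ★ `sum_neg_one_pow_Ico_one_eq`) -/

/-- **THE ONE-CLASS CLOSED VALUE.**  If the shell counts are `S 0 = F` and `S k = q^{k−1}·M` for `k ≥ 1` — BOTH first shells equal to `M`, with `M + F = q·F + 1` (the
`(q+1)`-regular tree with `F` fixed vertices of each type) — then for `m ≥ 1`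
`Σ_{k ≤ m} ξ_{m,k}·S k = q^{2m−3}·(q³F − F + 1)` (`m` even) ∕ `q^{2(m−1)}·(qF − q − F)` (`m` odd): ★ `sum_xiHCoeff_mul_shell_eq` at `N₀ = N₁ = M`, whose alternating
middle sum is `M·Σ_{1≤k<m}(−1)^k` (★ `sum_neg_one_pow_Ico_one_eq`). [cite: Macdonald1971, Ch. V §3] [cite: Serre1980Trees, I.6.4 Prop. 24] -/
theorem sum_xiHCoeff_mul_shell_eq_closed_of_firstShell_eq (q m : ℕ) (hm : 1 ≤ m) (S : ℕ → ℕ) (F M : ℕ) (hMF : M + F = q * F + 1)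
    (h0 : S 0 = F) (hS : ∀ k, 1 ≤ k → S k = q ^ (k - 1) * M) :
    ∑ k ∈ Finset.range (m + 1), xiHCoeff q m k * (S k : ℂ) =
      if Even m then (q : ℂ) ^ (2 * m - 3) * ((q : ℂ) ^ 3 * F - F + 1) else (q : ℂ) ^ (2 * (m - 1)) * ((q : ℂ) * F - q - F) := by
  rw [sum_xiHCoeff_mul_shell_eq q m hm S F M M h0 (fun k hk => by rw [ite_self]; exact hS k hk)]
  simp only [ite_self]
  rw [← Finset.sum_mul, sum_neg_one_pow_Ico_one_eq m hm]
  have hMℂ : (M : ℂ) = q * F + 1 - F := by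
    have h := congrArg (Nat.cast : ℕ → ℂ) hMF
    push_cast at h
    linear_combination h
  rcases Nat.even_or_odd m with he | ho
  · have hm2 : 2 ≤ m := by obtain ⟨k, hk⟩ := he; omega
    have e1 : (q : ℂ) ^ (2 * (m - 1)) = (q : ℂ) ^ (2 * m - 3) * q := by
      rw [← pow_succ]; congr 1; omega
    have e2 : (q : ℂ) ^ (2 * m - 1) = (q : ℂ) ^ (2 * m - 3) * q ^ 2 := by
      rw [← pow_add]; congr 1; omega
    rw [if_pos he, if_pos he, e1, e2, hMℂ, Even.neg_one_pow he]
    ring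
  · have hne : ¬ Even m := Nat.not_even_iff_odd.2 ho
    have e2 : (q : ℂ) ^ (2 * m - 1) = (q : ℂ) ^ (2 * (m - 1)) * q := by
      rw [← pow_succ]; congr 1; omega
    rw [if_neg hne, if_neg hne, e2, hMℂ, Odd.neg_one_pow ho]
    ring

/-! ## §2 G side (`X₃`, per class): the hyperspecial displacement shells as complex numbers in the two fixed-coset counts `V₀ = #Fix(U₃ ⧸ K₀)`, `V₁ = #Fix(U₃ ⧸ K₁)` -/

section GSide

open scoped Valued
open Literature.NumberTheory.Automorphic.UnitaryLatticeTree Literature.NumberTheory.Automorphic.CartanUnique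

variable {K : Type} [Field K] [Valued K ℤᵐ⁰] [ValuativeRel K] [(Valued.v : Valuation K ℤᵐ⁰).Compatible] {σ : K →+* K} {ϖ : K}

/-- **`S′(γ, 0) = V₀(γ)`**: the hyperspecial vertices displaced by `0` are the fixed hyperspecial vertices (★ G3-NUMBERS `ncard_selfDual_displaced_zero_eq_ncard_fixed_three`),
counted by the fixed cosets of `K₀ = U₃ ∩ GL₃(𝒪)` (★ DICT0 (D0.1) `natCard_fixedBy_quotient_glInt_eq_ncard_selfDual_fixed`). [cite: Kottwitz1988, §2] [cite: Serre1980Trees, II.1.1] -/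
theorem ncard_selfDual_displaced_zero_eq_natCard_fixedBy_three (hd : UnramifiedLocalConjDatum σ ϖ)
    (γ : ↥(unitaryGroupOfForm σ ((StdForm.antidiagonal 3).over K))) :
    {x : {M : Submodule 𝒪[K] (Fin 3 → K) // IsVertex σ ϖ ((StdForm.antidiagonal 3).over K) M} |
        IsSelfDualLattice σ ϖ ((StdForm.antidiagonal 3).over K) x.1 ∧
          (latticeGraph σ ϖ ((StdForm.antidiagonal 3).over K)).dist x
            (latticeGraphPerm σ ϖ ((StdForm.antidiagonal 3).over K) γ x) = 2 * 0}.ncard =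
      Nat.card (fixedBy (↥(unitaryGroupOfForm σ ((StdForm.antidiagonal 3).over K)) ⧸
        (glInt 3 K).subgroupOf (unitaryGroupOfForm σ ((StdForm.antidiagonal 3).over K))) γ) := by
  rw [ncard_selfDual_displaced_zero_eq_ncard_fixed_three hd γ, natCard_fixedBy_quotient_glInt_eq_ncard_selfDual_fixed hd γ]

/-- **`S′(γ, k)` FOR `k ≥ 1` AS A COMPLEX NUMBER IN `(V₀, V₁)`**: `S′(γ,k) = q^{2k−3}·(q³V₀ − V₁ + 1)` if `k` is even and `= q^{2(k−1)}·(qV₁ − V₀ + 1)` if `k` is odd —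
the cast of ★ GF1 2a §4 `ncard_selfDual_displaced_add_eq_of_natCard_fixedBy_eq` (stated additively in `ℕ` there), under its residual letters (`#𝓀 = q²`, `σ̄ = Frob_q`) and
the per-element finiteness letters `hfin₀ hfin₁ horb` of the RECORD head (the `Fintype` instance of 2a is BUILT from `hfin₀`).
[cite: Kottwitz1988, §2] [cite: Serre1980Trees, I.6.4 Prop. 24] [cite: Rogawski1990, §4.9 pp. 54–55] -/
theorem ncard_selfDual_displaced_cast_eq_of_natCard_fixedBy (hd : UnramifiedLocalConjDatum σ ϖ)
    (hσO : ∀ x : 𝒪[K], σ x ∈ 𝒪[K]) (σk : 𝓀[K] →+* 𝓀[K])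
    (hσk : ∀ x : 𝒪[K], IsLocalRing.residue 𝒪[K] ⟨σ x, hσO x⟩ = σk (IsLocalRing.residue 𝒪[K] x))
    [Fintype 𝓀[K]] {q : ℕ} (hq : Fintype.card 𝓀[K] = q ^ 2) (hfrob : ∀ y, σk y = y ^ q)
    (g₁ : GL (Fin 3) K) (hg₁ : (g₁ : Matrix (Fin 3) (Fin 3) K) = Matrix.diagonal ![(1 : K), 1, ϖ])
    (γ : ↥(unitaryGroupOfForm σ ((StdForm.antidiagonal 3).over K)))
    (hfin₀ : (fixedBy (↥(unitaryGroupOfForm σ ((StdForm.antidiagonal 3).over K)) ⧸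
      (glInt 3 K).subgroupOf (unitaryGroupOfForm σ ((StdForm.antidiagonal 3).over K))) γ).Finite)
    (hfin₁ : (fixedBy (↥(unitaryGroupOfForm σ ((StdForm.antidiagonal 3).over K)) ⧸
      ((glInt 3 K).map (MulAut.conj g₁).toMonoidHom).subgroupOf (unitaryGroupOfForm σ ((StdForm.antidiagonal 3).over K))) γ).Finite)
    (horb : (Set.range fun n : ℕ => ((γ ^ n : ↥(unitaryGroupOfForm σ ((StdForm.antidiagonal 3).over K))) :
      ↥(unitaryGroupOfForm σ ((StdForm.antidiagonal 3).over K)) ⧸ (glInt 3 K).subgroupOf (unitaryGroupOfForm σ ((StdForm.antidiagonal 3).over K)))).Finite)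
    (k : ℕ) (hk : 1 ≤ k) :
    (({x : {M : Submodule 𝒪[K] (Fin 3 → K) // IsVertex σ ϖ ((StdForm.antidiagonal 3).over K) M} |
        IsSelfDualLattice σ ϖ ((StdForm.antidiagonal 3).over K) x.1 ∧
          (latticeGraph σ ϖ ((StdForm.antidiagonal 3).over K)).dist x
            (latticeGraphPerm σ ϖ ((StdForm.antidiagonal 3).over K) γ x) = 2 * k}.ncard : ℕ) : ℂ) =
      if Even k then
        (q : ℂ) ^ (2 * k - 3) *
          ((q : ℂ) ^ 3 * (Nat.card (fixedBy (↥(unitaryGroupOfForm σ ((StdForm.antidiagonal 3).over K)) ⧸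
              (glInt 3 K).subgroupOf (unitaryGroupOfForm σ ((StdForm.antidiagonal 3).over K))) γ) : ℂ) -
            (Nat.card (fixedBy (↥(unitaryGroupOfForm σ ((StdForm.antidiagonal 3).over K)) ⧸
              ((glInt 3 K).map (MulAut.conj g₁).toMonoidHom).subgroupOf (unitaryGroupOfForm σ ((StdForm.antidiagonal 3).over K))) γ) : ℂ) + 1)
      else
        (q : ℂ) ^ (2 * (k - 1)) *
          ((q : ℂ) * (Nat.card (fixedBy (↥(unitaryGroupOfForm σ ((StdForm.antidiagonal 3).over K)) ⧸
              ((glInt 3 K).map (MulAut.conj g₁).toMonoidHom).subgroupOf (unitaryGroupOfForm σ ((StdForm.antidiagonal 3).over K))) γ) : ℂ) -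
            (Nat.card (fixedBy (↥(unitaryGroupOfForm σ ((StdForm.antidiagonal 3).over K)) ⧸
              (glInt 3 K).subgroupOf (unitaryGroupOfForm σ ((StdForm.antidiagonal 3).over K))) γ) : ℂ) + 1) := by
  classical
  haveI : Fintype (fixedBy (↥(unitaryGroupOfForm σ ((StdForm.antidiagonal 3).over K)) ⧸
      (glInt 3 K).subgroupOf (unitaryGroupOfForm σ ((StdForm.antidiagonal 3).over K))) γ) := hfin₀.fintype
  have h := ncard_selfDual_displaced_add_eq_of_natCard_fixedBy_eq hd hσO σk hσk hq hfrob g₁ hg₁ γ hfin₁ horb rfl rfl k hk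
  by_cases he : Even k
  · simp only [if_pos he] at h ⊢
    have h' := congrArg (Nat.cast : ℕ → ℂ) h
    push_cast at h'
    linear_combination h'
  · simp only [if_neg he] at h ⊢
    have h' := congrArg (Nat.cast : ℕ → ℂ) h
    push_cast at h'
    linear_combination h'

end GSide

/-! ## §3 H side (`X₂`, ONE class): from the two fixed counts `F₀(δ) = F₁(δ) = P` to every displacement shell -/

section HSide

open scoped ValuativeRel
open Literature.NumberTheory.Automorphic.HermitianLatticeTree

variable {K : Type} [Field K] [Valued K ℤᵐ⁰] [ValuativeRel K] [(Valued.v : Valuation K ℤᵐ⁰).Compatible] {σ : K →+* K} {ϖ : K}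

/-- **THE H-SIDE SHELLS FROM `F₀(δ) = F₁(δ) = P ≥ 1`.**  On the `(q+1)`-regular, locally finite tree `X₂` (`hloc`, `hreg`), let `δ ∈ U₂` fix exactly `P` self-dual and
`P` `ϖ`-modular vertices (the ★ HF2 counts of the type-(2) corner, as VALUE letters).  Then `Fix(δ)` is finite with a fixed vertex, the two first shells coincide —
`N₀ = N₁ = M` with `M + P = q·P + 1` (★ GF1 FILE 1 `ncard_displaced_two_inter_type_add_card_fixed_eq` at `d ≡ q+1` for BOTH colours: `N_i + 2P = (q+1)P + 1`) — and
`S₂(δ, k) = q^{k−1}·M` for every `k ≥ 1` (★ H2-NUMBERS `ncard_selfDual_displaced_eq_pow_mul_firstShell_two`).  The edge-midpoint symmetry of the ramified torus replaces the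
type swap of type (1). [cite: Serre1980Trees, I.6.4 Prop. 24; II.1.1] [cite: Kottwitz1988, §2] [cite: Rogawski1990, §3.6 Lemma 3.6.1 p. 28] -/
theorem exists_firstShell_of_ncard_fixed_eq (hd : HermitianLattice.UnramifiedLocalConjDatum σ ϖ)
    (δ : ↥(unitaryGroupOfForm σ ((StdForm.antidiagonal 2).over K))) {q : ℕ}
    (hloc : ∀ v, ((latticeTree σ ϖ ((StdForm.antidiagonal 2).over K)).neighborSet v).Finite)
    (hreg : ∀ v, ((latticeTree σ ϖ ((StdForm.antidiagonal 2).over K)).neighborSet v).ncard = q + 1)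
    {P : ℕ} (hP : 1 ≤ P)
    (hF0 : {x : {M : Submodule 𝒪[K] (Fin 2 → K) // IsSpecialLattice σ ϖ ((StdForm.antidiagonal 2).over K) M} |
      IsSelfDualLattice σ ((StdForm.antidiagonal 2).over K) x.1 ∧ latticeTreeIso σ ϖ ((StdForm.antidiagonal 2).over K) δ x = x}.ncard = P)
    (hF1 : {x : {M : Submodule 𝒪[K] (Fin 2 → K) // IsSpecialLattice σ ϖ ((StdForm.antidiagonal 2).over K) M} |
      IsModularLattice σ ϖ ((StdForm.antidiagonal 2).over K) x.1 ∧ latticeTreeIso σ ϖ ((StdForm.antidiagonal 2).over K) δ x = x}.ncard = P) :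
    ∃ M : ℕ, M + P = q * P + 1 ∧ ∀ k, 1 ≤ k →
      {x : {M : Submodule 𝒪[K] (Fin 2 → K) // IsSpecialLattice σ ϖ ((StdForm.antidiagonal 2).over K) M} |
          IsSelfDualLattice σ ((StdForm.antidiagonal 2).over K) x.1 ∧
            (latticeTree σ ϖ ((StdForm.antidiagonal 2).over K)).dist x (latticeTreeIso σ ϖ ((StdForm.antidiagonal 2).over K) δ x) = 2 * k}.ncard =
        q ^ (k - 1) * M := by
  classical
  haveI := isDiscreteValuationRing_integer_of_compatible hd.vϖ
  have hσv := valuation_map_eq_of_datum hd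
  have hϖ := isUniformizingElement_of_v_eq hd.vϖ
  have hT := isTree_latticeTree σ hσv hϖ (isUnimodular₂_antidiagonal_two (K := K))
  haveI : (latticeTree σ ϖ ((StdForm.antidiagonal 2).over K)).LocallyFinite := fun v => (hloc v).fintype
  -- a type function `c` (`c v = 0 ↔ v` self-dual, `c v = 1 ↔ v` `ϖ`-modular)
  obtain ⟨c, hc0⟩ : ∃ c : {M : Submodule 𝒪[K] (Fin 2 → K) // IsSpecialLattice σ ϖ ((StdForm.antidiagonal 2).over K) M} → Fin 2,
      ∀ v, c v = 0 ↔ IsSelfDualLattice σ ((StdForm.antidiagonal 2).over K) v.1 :=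
    ⟨fun v => if IsSelfDualLattice σ ((StdForm.antidiagonal 2).over K) v.1 then 0 else 1, fun v => by
      by_cases h : IsSelfDualLattice σ ((StdForm.antidiagonal 2).over K) v.1
      · simp [h]
      · simp [h]⟩
  have hcadj := typeFun_ne_of_adj_two hd c hc0
  have hdisj : ∀ v : {M : Submodule 𝒪[K] (Fin 2 → K) // IsSpecialLattice σ ϖ ((StdForm.antidiagonal 2).over K) M},
      IsSelfDualLattice σ ((StdForm.antidiagonal 2).over K) v.1 → ¬ IsModularLattice σ ϖ ((StdForm.antidiagonal 2).over K) v.1 :=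
    fun v h1 h2 => not_isModularLattice_of_isSelfDualLattice σ hσv hϖ _ h1 h2
  have hc1 : ∀ v : {M : Submodule 𝒪[K] (Fin 2 → K) // IsSpecialLattice σ ϖ ((StdForm.antidiagonal 2).over K) M},
      c v = 1 ↔ IsModularLattice σ ϖ ((StdForm.antidiagonal 2).over K) v.1 := by
    intro v
    constructor
    · intro h
      rcases v.2 with hsd | hmd
      · exact absurd ((hc0 v).2 hsd) (by rw [h]; decide)
      · exact hmd
    · intro hmd
      have h0 : c v ≠ 0 := fun h0 => hdisj v ((hc0 v).1 h0) hmd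
      revert h0; generalize c v = x; revert x; decide
  -- the two fixed halves, both of size `P`
  have hF0' : {v : {M : Submodule 𝒪[K] (Fin 2 → K) // IsSpecialLattice σ ϖ ((StdForm.antidiagonal 2).over K) M} |
      latticeTreeIso σ ϖ ((StdForm.antidiagonal 2).over K) δ v = v ∧ c v = 0}.ncard = P := by
    rw [← hF0]; congr 1; ext v; simp only [Set.mem_setOf_eq, hc0]; exact and_comm
  have hF1' : {v : {M : Submodule 𝒪[K] (Fin 2 → K) // IsSpecialLattice σ ϖ ((StdForm.antidiagonal 2).over K) M} |
      latticeTreeIso σ ϖ ((StdForm.antidiagonal 2).over K) δ v = v ∧ c v = 1}.ncard = P := by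
    rw [← hF1]; congr 1; ext v; simp only [Set.mem_setOf_eq, hc1]; exact and_comm
  have hfin0 : {v : {M : Submodule 𝒪[K] (Fin 2 → K) // IsSpecialLattice σ ϖ ((StdForm.antidiagonal 2).over K) M} |
      latticeTreeIso σ ϖ ((StdForm.antidiagonal 2).over K) δ v = v ∧ c v = 0}.Finite := Set.finite_of_ncard_ne_zero (by rw [hF0']; omega)
  have hfin1 : {v : {M : Submodule 𝒪[K] (Fin 2 → K) // IsSpecialLattice σ ϖ ((StdForm.antidiagonal 2).over K) M} |
      latticeTreeIso σ ϖ ((StdForm.antidiagonal 2).over K) δ v = v ∧ c v = 1}.Finite := Set.finite_of_ncard_ne_zero (by rw [hF1']; omega)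
  have hsplit : {v : {M : Submodule 𝒪[K] (Fin 2 → K) // IsSpecialLattice σ ϖ ((StdForm.antidiagonal 2).over K) M} |
      latticeTreeIso σ ϖ ((StdForm.antidiagonal 2).over K) δ v = v} =
      {v | latticeTreeIso σ ϖ ((StdForm.antidiagonal 2).over K) δ v = v ∧ c v = 0} ∪
        {v | latticeTreeIso σ ϖ ((StdForm.antidiagonal 2).over K) δ v = v ∧ c v = 1} := by
    ext v
    simp only [Set.mem_setOf_eq, Set.mem_union]
    constructor
    · intro h
      rcases v.2 with hsd | hmd
      · exact Or.inl ⟨h, (hc0 v).2 hsd⟩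
      · exact Or.inr ⟨h, (hc1 v).2 hmd⟩
    · rintro (⟨h, -⟩ | ⟨h, -⟩) <;> exact h
  have hfix : {v : {M : Submodule 𝒪[K] (Fin 2 → K) // IsSpecialLattice σ ϖ ((StdForm.antidiagonal 2).over K) M} |
      latticeTreeIso σ ϖ ((StdForm.antidiagonal 2).over K) δ v = v}.Finite := by rw [hsplit]; exact hfin0.union hfin1
  have hF : {v : {M : Submodule 𝒪[K] (Fin 2 → K) // IsSpecialLattice σ ϖ ((StdForm.antidiagonal 2).over K) M} |
      latticeTreeIso σ ϖ ((StdForm.antidiagonal 2).over K) δ v = v}.ncard = P + P := by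
    rw [hsplit, Set.ncard_union_eq (Set.disjoint_left.2 fun v h0 h1 => absurd (h0.2.symm.trans h1.2) (by decide)) hfin0 hfin1, hF0', hF1']
  obtain ⟨u, hu, -⟩ : {v : {M : Submodule 𝒪[K] (Fin 2 → K) // IsSpecialLattice σ ϖ ((StdForm.antidiagonal 2).over K) M} |
      latticeTreeIso σ ϖ ((StdForm.antidiagonal 2).over K) δ v = v ∧ c v = 0}.Nonempty := Set.nonempty_of_ncard_ne_zero (by rw [hF0']; omega)
  have hFcard : hfix.toFinset.card = P + P := by rw [← Set.ncard_eq_toFinset_card _ hfix, hF]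
  -- valency as a `degree` statement at the fixed vertices
  have hdeg' : ∀ y, latticeTreeIso σ ϖ ((StdForm.antidiagonal 2).over K) δ y = y →
      (latticeTree σ ϖ ((StdForm.antidiagonal 2).over K)).degree y = (fun _ : Fin 2 => q + 1) (c y) := fun y _ => by
    rw [← SimpleGraph.card_neighborFinset_eq_degree, ← hreg y, SimpleGraph.neighborFinset_def, Set.ncard_eq_toFinset_card']
  -- ★ GF1 FILE 1 for both colours: `N_i + 2P = (q+1)·P + 1`
  have hN : ∀ i : Fin 2,
      {x : {M : Submodule 𝒪[K] (Fin 2 → K) // IsSpecialLattice σ ϖ ((StdForm.antidiagonal 2).over K) M} |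
          (latticeTree σ ϖ ((StdForm.antidiagonal 2).over K)).dist x (latticeTreeIso σ ϖ ((StdForm.antidiagonal 2).over K) δ x) = 2 ∧ c x = i}.ncard + P =
        q * P + 1 := by
    intro i
    obtain ⟨j, hij⟩ : ∃ j : Fin 2, i ≠ j := ⟨i + 1, by revert i; decide⟩
    have hFj : (hfix.toFinset.filter (fun y => c y = j)).card = P := by
      have e : (hfix.toFinset.filter (fun y => c y = j) : Set _) =
          {v | latticeTreeIso σ ϖ ((StdForm.antidiagonal 2).over K) δ v = v ∧ c v = j} := by
        ext v; simp only [Finset.coe_filter, Set.Finite.mem_toFinset, Set.mem_setOf_eq]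
      rw [← Set.ncard_coe_finset, e]
      fin_cases j
      · exact hF0'
      · exact hF1'
    have hsum := ncard_displaced_two_inter_type_add_card_fixed_eq hT (latticeTreeIso σ ϖ ((StdForm.antidiagonal 2).over K) δ) hu hfix c hcadj hij
      (fun _ : Fin 2 => q + 1) hdeg'
    rw [hFj, hFcard, add_mul, one_mul] at hsum
    omega
  refine ⟨{x : {M : Submodule 𝒪[K] (Fin 2 → K) // IsSpecialLattice σ ϖ ((StdForm.antidiagonal 2).over K) M} |
      (latticeTree σ ϖ ((StdForm.antidiagonal 2).over K)).dist x (latticeTreeIso σ ϖ ((StdForm.antidiagonal 2).over K) δ x) = 2 ∧ c x = 0}.ncard,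
    hN 0, fun k hk => ?_⟩
  have h01 : {x : {M : Submodule 𝒪[K] (Fin 2 → K) // IsSpecialLattice σ ϖ ((StdForm.antidiagonal 2).over K) M} |
      (latticeTree σ ϖ ((StdForm.antidiagonal 2).over K)).dist x (latticeTreeIso σ ϖ ((StdForm.antidiagonal 2).over K) δ x) = 2 ∧ c x = 1}.ncard =
      {x : {M : Submodule 𝒪[K] (Fin 2 → K) // IsSpecialLattice σ ϖ ((StdForm.antidiagonal 2).over K) M} |
        (latticeTree σ ϖ ((StdForm.antidiagonal 2).over K)).dist x (latticeTreeIso σ ϖ ((StdForm.antidiagonal 2).over K) δ x) = 2 ∧ c x = 0}.ncard := by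
    have h0 := hN 0
    have h1 := hN 1
    omega
  rw [ncard_selfDual_displaced_eq_pow_mul_firstShell_two δ hd hloc hu hfix c hc0 q (fun v _ => hreg v) k hk]
  by_cases he : Even k
  · rw [if_pos he, h01]
  · rw [if_neg he]

end HSide

end Summit.HodgeConjecture.HodgeConjecture.R90.S6

end
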